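import Literature.NumberTheory.LFunctions.Zhang2022.DetectorDoublingIdentity

/-!
# The TWO-POINT identity (K2″): the glued two-sided boundary form is `c₀` times the energy of ONE extremal arc
# with jets prescribed at BOTH ends

Sub-cell E of the `landau-siegel` programme (row S-E-p6-3 «two-sided glued det class at general `b`»; ls-theory g2
2026-08-27T03:01:33Z «two-point K2 = the 𝒫 identities (R)(L)(X); assembly»; LEVERS §0.13 (xxiii)). Discovery and exact
verification of record: ls-num-2 g4 2026-08-27T02:24:31Z «Id-5» (Laurent-polynomial zero, kit j266016; A-twin ls-num-1 g3
j265851; ledger l.7397/l.7402), independently ls-barrier-num g3 (H-CLOSED-FORM successor memo TWO-SIDED-CIRCLE.md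
848781c68d919926; Gaussian-rational points kit j266075; sympy zero with symbolic `π` kit j266471). ORIENTATION = p5's PERIODIC
one (`DetectorDoublingClamped`/`Identity`, p487229/p488794): exponential extremals `F = γ₀ + Σ_m γ_(m+1) e^(−iπ b_m t)` of the bulk
form `Det.bulkFormOn b` on `[0,1]`.

What is here (all exact algebra over the atoms `u_m = e^(iπb_m/2)`, `π`, `b`; 0 facts, 0 sorries):

* Part 1 — the REFLECTION `t ↦ 1 − t` composed with complex conjugation and a sign maps extremals to extremals:
  `Det.reflCoeff b γ` with `extremal b (reflCoeff b γ) t = −conj (extremal b γ (1 − t))` and the companions for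
  `F′, F″, F‴` (signs `+, −, +`). This is the profile image of the functional-equation reflection `R̃g(y) = conj g(1−y)`
  (`reflProfile`) on tail primitives, with the sign that the glue constant `c_g = −e^(iπΣb/2)` (`Det.shiftGlue0`) carries.
* Part 2 — the TWO-POINT extremal `E = F⋆_(p₁,q₁) + refl(F⋆_(p₂,q₂))` (`Det.twoPointCoeff`): jets
  `(E, E′)(0) = (−conj p₂, conj q₂)` and `(E, E′)(1) = (p₁, q₁)` (from the clamped solve of part B; same solvability
  `Q ≠ 0 ⟺ c₀ ≠ 0`, `Det.doublingDet`; nothing new).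
* Part 3 — the JET MAP AT THE CLAMPED END of `F⋆_x` (`clampedExtDD_zero`, `clampedExtDDD_zero`): the «reaction» jets
  `F⋆″(0)`, `F⋆‴(0)` as explicit linear forms in `x` with atom coefficients (CAS data: ls-barrier-num g3 kit j266576).
* Part 4 — **`Det.twoPointIdentity`**: for pairwise-distinct `b` with `Q ≠ 0`,
  `c₀·T_b^([0,1])(E) = freeEndForm b p₁ q₁ + freeEndForm b p₂ q₂ + π·Re(twoPointGlue b p₁ q₁ p₂ q₂)`, where
  `twoPointGlue` is the cell's formula-II glue block `F0DetC (shiftGlueW b) (shiftGlue0 b) b (−q₁) p₁ (−q₂) p₂` written in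
  atoms (`−i[A_{N/b}·q₁q₂ + iπA_N(q₁p₂ + p₁q₂) − π²e₃A₀·p₁p₂ − u₀u₁u₂·q₁q₂]`; the dictionary lemma lives with the assembly).
  The one-point doubling identity D1 (`Det.doublingIdentity_clamped`) is the case `p₂ = q₂ = 0`.
* Part 5 — the same under `c₀ ≠ 0` and in the ∃-shape (`Det.twoPoint_pieces`) that the two-sided assembly leaf
  `DetectorTwoSidedCompose` (ls-barrier-p5 g4) consumes as its `hK2″` hypothesis.

With K1 (`formDet_shiftRecipe_eq_bulk_add_freeEnd`, twice), K3′ (`bulkFormOn_circle_nonneg_of_signAdmissible`, nodes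
`{t₁, 1 − t₂, 1}`), K4/K5, this identity gives `Det.FormDetGlued b ⪰ 0` on the whole no-overlap two-sided class for every
sign-admissible `b` (assembly file). Nothing here asserts anything about `L`-functions or about the manuscript's formula II
at general shifts (the glue pair `(W·N/b, −e^(iπΣb/2))` is the cell's object of record, `DetectorGlueForm` STATUS NOTES).
«The programme SEARCHES and TYPES; no claim about Landau–Siegel zeros, Theorems 1–2 of arXiv:2211.02515 or a repaired
Margin232 until a kernel theorem says so.» -/

noncomputable section

open Complex Real ComplexConjugate

namespace Literature.NumberTheory.LFunctions.Zhang2022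

namespace Det

/-! ### Part 1 — reflection `t ↦ 1 − t` with conjugation and a sign preserves the extremal span -/

section Reflection

variable (b : Fin 3 → ℝ) (γ : Fin 4 → ℂ)

/-- Coefficients of the reflected extremal `t ↦ −conj F(1 − t)`: `(−conj γ₀; −conj γ_(m+1)·u_m²)`.
[cite: Zhang2022LandauSiegel, §12 (12.6)–(12.8); §7 Prop. 7.1 p.44] -/
def reflCoeff (b : Fin 3 → ℝ) (γ : Fin 4 → ℂ) : Fin 4 → ℂ :=
  ![-conj (γ 0), -conj (γ 1) * halfUnit b 0 ^ 2, -conj (γ 2) * halfUnit b 1 ^ 2, -conj (γ 3) * halfUnit b 2 ^ 2]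

/-- Entry `0` of the reflected coefficient vector. [cite: Zhang2022LandauSiegel, §12 (12.6)–(12.8); §7 Prop. 7.1 p.44] -/
@[simp] theorem reflCoeff_zero : reflCoeff b γ 0 = -conj (γ 0) := rfl

/-- Entries `m+1` of the reflected coefficient vector. [cite: Zhang2022LandauSiegel, §12 (12.6)–(12.8); §7 Prop. 7.1 p.44] -/
theorem reflCoeff_succ (m : Fin 3) : reflCoeff b γ m.succ = -conj (γ m.succ) * halfUnit b m ^ 2 := by
  fin_cases m <;> rfl

/-- `conj e^(−iπb_m(1−t)) = u_m²·e^(−iπb_m t)` (the reflection acts diagonally on the modes). [cite: Zhang2022LandauSiegel, §12 (12.6)–(12.8); §7 Prop. 7.1 p.44] -/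
theorem conj_cexp_mode_one_sub (m : Fin 3) (t : ℝ) :
    conj (cexp (-(I * π * (b m : ℂ) * ((1 - t : ℝ) : ℂ)))) = halfUnit b m ^ 2 * cexp (-(I * π * (b m : ℂ) * t)) := by
  rw [← Complex.exp_conj]
  unfold halfUnit
  rw [sq, ← Complex.exp_add, ← Complex.exp_add]
  congr 1
  simp only [map_neg, map_mul, Complex.conj_I, Complex.conj_ofReal]
  push_cast
  ring

/-- **Reflection of an extremal is an extremal**: `extremal b (reflCoeff b γ) t = −conj (extremal b γ (1 − t))`.
[cite: Zhang2022LandauSiegel, §12 (12.6)–(12.8); §7 Prop. 7.1 p.44] -/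
theorem extremal_reflCoeff (t : ℝ) : extremal b (reflCoeff b γ) t = -conj (extremal b γ (1 - t)) := by
  unfold extremal
  simp only [map_add, map_mul, Fin.sum_univ_three, reflCoeff_zero]
  rw [reflCoeff_succ b γ 0, reflCoeff_succ b γ 1, reflCoeff_succ b γ 2]
  have h0 := conj_cexp_mode_one_sub b 0 t
  have h1 := conj_cexp_mode_one_sub b 1 t
  have h2 := conj_cexp_mode_one_sub b 2 t
  simp only [Fin.succ_zero_eq_one, Fin.succ_one_eq_two] at *
  have e2 : (Fin.succ (2 : Fin 3)) = (3 : Fin 4) := rfl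
  simp only [e2] at *
  push_cast at h0 h1 h2 ⊢
  rw [h0, h1, h2]
  ring

/-- First derivative: `extremalD b (reflCoeff b γ) t = conj (extremalD b γ (1 − t))`. [cite: Zhang2022LandauSiegel, §7 Prop. 7.1 p.44] -/
theorem extremalD_reflCoeff (t : ℝ) : extremalD b (reflCoeff b γ) t = conj (extremalD b γ (1 - t)) := by
  unfold extremalD
  simp only [Fin.sum_univ_three, map_add, map_mul, map_neg, Complex.conj_I, Complex.conj_ofReal]
  rw [reflCoeff_succ b γ 0, reflCoeff_succ b γ 1, reflCoeff_succ b γ 2]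
  have h0 := conj_cexp_mode_one_sub b 0 t
  have h1 := conj_cexp_mode_one_sub b 1 t
  have h2 := conj_cexp_mode_one_sub b 2 t
  simp only [Fin.succ_zero_eq_one, Fin.succ_one_eq_two] at *
  have e2 : (Fin.succ (2 : Fin 3)) = (3 : Fin 4) := rfl
  simp only [e2] at *
  push_cast at h0 h1 h2 ⊢
  rw [h0, h1, h2]
  ring

/-- Second derivative: `extremalDD b (reflCoeff b γ) t = −conj (extremalDD b γ (1 − t))`. [cite: Zhang2022LandauSiegel, §7 Prop. 7.1 p.44] -/
theorem extremalDD_reflCoeff (t : ℝ) : extremalDD b (reflCoeff b γ) t = -conj (extremalDD b γ (1 - t)) := by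
  unfold extremalDD
  simp only [Fin.sum_univ_three, map_add, map_mul, map_neg, map_pow, Complex.conj_I, Complex.conj_ofReal]
  rw [reflCoeff_succ b γ 0, reflCoeff_succ b γ 1, reflCoeff_succ b γ 2]
  have h0 := conj_cexp_mode_one_sub b 0 t
  have h1 := conj_cexp_mode_one_sub b 1 t
  have h2 := conj_cexp_mode_one_sub b 2 t
  simp only [Fin.succ_zero_eq_one, Fin.succ_one_eq_two] at *
  have e2 : (Fin.succ (2 : Fin 3)) = (3 : Fin 4) := rfl
  simp only [e2] at *
  push_cast at h0 h1 h2 ⊢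
  rw [h0, h1, h2]
  ring

/-- Third derivative: `extremalDDD b (reflCoeff b γ) t = conj (extremalDDD b γ (1 − t))`. [cite: Zhang2022LandauSiegel, §7 Prop. 7.1 p.44] -/
theorem extremalDDD_reflCoeff (t : ℝ) : extremalDDD b (reflCoeff b γ) t = conj (extremalDDD b γ (1 - t)) := by
  unfold extremalDDD
  simp only [Fin.sum_univ_three, map_add, map_mul, map_neg, map_pow, Complex.conj_I, Complex.conj_ofReal]
  rw [reflCoeff_succ b γ 0, reflCoeff_succ b γ 1, reflCoeff_succ b γ 2]
  have h0 := conj_cexp_mode_one_sub b 0 t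
  have h1 := conj_cexp_mode_one_sub b 1 t
  have h2 := conj_cexp_mode_one_sub b 2 t
  simp only [Fin.succ_zero_eq_one, Fin.succ_one_eq_two] at *
  have e2 : (Fin.succ (2 : Fin 3)) = (3 : Fin 4) := rfl
  simp only [e2] at *
  push_cast at h0 h1 h2 ⊢
  rw [h0, h1, h2]
  ring

end Reflection

/-! ### Part 2 — linearity of the extremal in `γ`, and the two-point extremal -/

section TwoPoint

variable (b : Fin 3 → ℝ)

/-- `extremal` is additive in the coefficient vector. [cite: Zhang2022LandauSiegel, §7 Prop. 7.1 p.44] -/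
theorem extremal_add (γ δ : Fin 4 → ℂ) (t : ℝ) : extremal b (γ + δ) t = extremal b γ t + extremal b δ t := by
  simp only [extremal, Pi.add_apply, Finset.sum_add_distrib, add_mul]
  ring

/-- `extremalD` is additive in the coefficient vector. [cite: Zhang2022LandauSiegel, §7 Prop. 7.1 p.44] -/
theorem extremalD_add (γ δ : Fin 4 → ℂ) (t : ℝ) : extremalD b (γ + δ) t = extremalD b γ t + extremalD b δ t := by
  simp only [extremalD, Pi.add_apply, Finset.sum_add_distrib, add_mul]

/-- `extremalDD` is additive in the coefficient vector. [cite: Zhang2022LandauSiegel, §7 Prop. 7.1 p.44] -/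
theorem extremalDD_add (γ δ : Fin 4 → ℂ) (t : ℝ) : extremalDD b (γ + δ) t = extremalDD b γ t + extremalDD b δ t := by
  simp only [extremalDD, Pi.add_apply, Finset.sum_add_distrib, add_mul]

/-- `extremalDDD` is additive in the coefficient vector. [cite: Zhang2022LandauSiegel, §7 Prop. 7.1 p.44] -/
theorem extremalDDD_add (γ δ : Fin 4 → ℂ) (t : ℝ) :
    extremalDDD b (γ + δ) t = extremalDDD b γ t + extremalDDD b δ t := by
  simp only [extremalDDD, Pi.add_apply, Finset.sum_add_distrib, add_mul]

/-- **Coefficients of the TWO-POINT extremal** with jets `(−conj p₂, conj q₂)` at `t = 0` and `(p₁, q₁)` at `t = 1`: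
the clamped extremal of the side-1 data plus the reflected clamped extremal of the side-2 data.
[cite: Zhang2022LandauSiegel, §7 Prop. 7.1 p.44; §12 (12.6)–(12.8); Prop 14.1, Lemma 15.1] -/
def twoPointCoeff (b : Fin 3 → ℝ) (p₁ q₁ p₂ q₂ : ℂ) : Fin 4 → ℂ :=
  clampedCoeff b p₁ q₁ + reflCoeff b (clampedCoeff b p₂ q₂)

variable (p₁ q₁ p₂ q₂ : ℂ)

/-- `E(0) = −conj p₂`. [cite: Zhang2022LandauSiegel, §7 Prop. 7.1 p.44; Lemma 15.1] -/
theorem twoPointExt_zero (hQ : dblQ b ≠ 0) : extremal b (twoPointCoeff b p₁ q₁ p₂ q₂) 0 = -conj p₂ := by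
  unfold twoPointCoeff
  rw [extremal_add, extremal_reflCoeff, clampedExt_zero b p₁ q₁ hQ]
  norm_num [clampedExt_one b p₂ q₂ hQ]

/-- `E′(0) = conj q₂`. [cite: Zhang2022LandauSiegel, §7 Prop. 7.1 p.44; Lemma 15.1] -/
theorem twoPointExtD_zero (hQ : dblQ b ≠ 0) : extremalD b (twoPointCoeff b p₁ q₁ p₂ q₂) 0 = conj q₂ := by
  unfold twoPointCoeff
  rw [extremalD_add, extremalD_reflCoeff, clampedExtD_zero b p₁ q₁ hQ]
  norm_num [clampedExtD_one b p₂ q₂ hQ]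

/-- `E(1) = p₁`. [cite: Zhang2022LandauSiegel, §7 Prop. 7.1 p.44; Lemma 15.1] -/
theorem twoPointExt_one (hQ : dblQ b ≠ 0) : extremal b (twoPointCoeff b p₁ q₁ p₂ q₂) 1 = p₁ := by
  unfold twoPointCoeff
  rw [extremal_add, extremal_reflCoeff, clampedExt_one b p₁ q₁ hQ]
  norm_num [clampedExt_zero b p₂ q₂ hQ]

/-- `E′(1) = q₁`. [cite: Zhang2022LandauSiegel, §7 Prop. 7.1 p.44; Lemma 15.1] -/
theorem twoPointExtD_one (hQ : dblQ b ≠ 0) : extremalD b (twoPointCoeff b p₁ q₁ p₂ q₂) 1 = q₁ := by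
  unfold twoPointCoeff
  rw [extremalD_add, extremalD_reflCoeff, clampedExtD_one b p₁ q₁ hQ]
  norm_num [clampedExtD_zero b p₂ q₂ hQ]

/-- `E″(1) = F⋆″_(p₁,q₁)(1) − conj F⋆″_(p₂,q₂)(0)`. [cite: Zhang2022LandauSiegel, §7 Prop. 7.1 p.44] -/
theorem twoPointExtDD_one :
    extremalDD b (twoPointCoeff b p₁ q₁ p₂ q₂) 1
      = extremalDD b (clampedCoeff b p₁ q₁) 1 - conj (extremalDD b (clampedCoeff b p₂ q₂) 0) := by
  unfold twoPointCoeff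
  rw [extremalDD_add, extremalDD_reflCoeff]
  norm_num
  ring

/-- `E‴(1) = F⋆‴_(p₁,q₁)(1) + conj F⋆‴_(p₂,q₂)(0)`. [cite: Zhang2022LandauSiegel, §7 Prop. 7.1 p.44] -/
theorem twoPointExtDDD_one :
    extremalDDD b (twoPointCoeff b p₁ q₁ p₂ q₂) 1
      = extremalDDD b (clampedCoeff b p₁ q₁) 1 + conj (extremalDDD b (clampedCoeff b p₂ q₂) 0) := by
  unfold twoPointCoeff
  rw [extremalDDD_add, extremalDDD_reflCoeff]
  norm_num

/-- `E″(0) = F⋆″_(p₁,q₁)(0) − conj F⋆″_(p₂,q₂)(1)`. [cite: Zhang2022LandauSiegel, §7 Prop. 7.1 p.44] -/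
theorem twoPointExtDD_zero :
    extremalDD b (twoPointCoeff b p₁ q₁ p₂ q₂) 0
      = extremalDD b (clampedCoeff b p₁ q₁) 0 - conj (extremalDD b (clampedCoeff b p₂ q₂) 1) := by
  unfold twoPointCoeff
  rw [extremalDD_add, extremalDD_reflCoeff]
  norm_num
  ring

/-- `E‴(0) = F⋆‴_(p₁,q₁)(0) + conj F⋆‴_(p₂,q₂)(1)`. [cite: Zhang2022LandauSiegel, §7 Prop. 7.1 p.44] -/
theorem twoPointExtDDD_zero :
    extremalDDD b (twoPointCoeff b p₁ q₁ p₂ q₂) 0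
      = extremalDDD b (clampedCoeff b p₁ q₁) 0 + conj (extremalDDD b (clampedCoeff b p₂ q₂) 1) := by
  unfold twoPointCoeff
  rw [extremalDDD_add, extremalDDD_reflCoeff]
  norm_num

end TwoPoint

/-! ### Part 3 — the glue atom `A_{N/b} = Σ_j W_j N_j / b_j` and the JET MAP AT THE CLAMPED END -/

section GlueAtom

variable (b : Fin 3 → ℝ)

/-- `W_j/b_j` with the division performed symbolically: `ω_j(b) = e^(iπ(s_j − b_j)/2)/v_j` (so `W_j = b_j·ω_j`, and the
cell's glue weight `W′_j = W_j N_j/b_j` is `N_j·ω_j` without dividing by `b_j`). [cite: Zhang2022LandauSiegel, proof of Prop 7.1, (7.19)–(7.21); Lemma 15.1] -/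
def shiftWoverB (b : Fin 3 → ℝ) (j : Fin 3) : ℂ :=
  cexp (I * π * (((shiftS b j - b j) / 2 : ℝ) : ℂ)) / (shiftVdm b j : ℂ)

/-- `W_j = b_j·ω_j`. [cite: Zhang2022LandauSiegel, proof of Prop 7.1, (7.19)–(7.21)] -/
theorem shiftW_eq_mul_shiftWoverB (j : Fin 3) : shiftW b j = (b j : ℂ) * shiftWoverB b j := by
  unfold shiftW shiftWoverB
  ring

/-- **The glue atom** `A_{N/b}(b) := Σ_j N_j(b)·ω_j(b)` (`= Σ_j W′_j`, the sum of the cell's formula-II glue weights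
`Det.shiftGlueW`). [cite: Zhang2022LandauSiegel, Prop 14.1, Lemma 15.1, §18 (18.1)] -/
def atomG (b : Fin 3 → ℝ) : ℂ := ∑ j : Fin 3, (shiftN b j : ℂ) * shiftWoverB b j

/-- `ω₀ = (u₁u₂/u₀)/((b₁−b₀)(b₂−b₀))`. [cite: Zhang2022LandauSiegel, proof of Prop 7.1, (7.19)–(7.21)] -/
theorem shiftWoverB_zero_halfUnit :
    shiftWoverB b 0 = (halfUnit b 1 * halfUnit b 2 / halfUnit b 0) / (((b 1 - b 0) * (b 2 - b 0) : ℝ) : ℂ) := by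
  unfold shiftWoverB shiftS shiftVdm halfUnit
  simp only [Matrix.cons_val_zero]
  rw [div_eq_mul_inv (cexp _ * cexp _), ← Complex.exp_add, ← Complex.exp_neg, ← Complex.exp_add]
  congr 2
  push_cast
  ring

/-- `ω₁ = (u₂u₀/u₁)/((b₂−b₁)(b₀−b₁))`. [cite: Zhang2022LandauSiegel, proof of Prop 7.1, (7.19)–(7.21)] -/
theorem shiftWoverB_one_halfUnit :
    shiftWoverB b 1 = (halfUnit b 2 * halfUnit b 0 / halfUnit b 1) / (((b 2 - b 1) * (b 0 - b 1) : ℝ) : ℂ) := by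
  unfold shiftWoverB shiftS shiftVdm halfUnit
  simp only [Matrix.cons_val_one]
  rw [div_eq_mul_inv (cexp _ * cexp _), ← Complex.exp_add, ← Complex.exp_neg, ← Complex.exp_add]
  congr 2
  push_cast
  ring

/-- `ω₂ = (u₀u₁/u₂)/((b₀−b₂)(b₁−b₂))`. [cite: Zhang2022LandauSiegel, proof of Prop 7.1, (7.19)–(7.21)] -/
theorem shiftWoverB_two_halfUnit :
    shiftWoverB b 2 = (halfUnit b 0 * halfUnit b 1 / halfUnit b 2) / (((b 0 - b 2) * (b 1 - b 2) : ℝ) : ℂ) := by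
  unfold shiftWoverB shiftS shiftVdm halfUnit
  simp only [Matrix.cons_val_two, Matrix.tail_cons, Matrix.head_cons]
  rw [div_eq_mul_inv (cexp _ * cexp _), ← Complex.exp_add, ← Complex.exp_neg, ← Complex.exp_add]
  congr 2
  push_cast
  ring

/-- `A_{N/b}` in half-angle units. [cite: Zhang2022LandauSiegel, Lemma 15.1; §8 (8.13)–(8.18)] -/
theorem atomG_halfUnit : atomG b =
    ((b 1 * b 2 : ℝ) : ℂ) * ((halfUnit b 1 * halfUnit b 2 / halfUnit b 0) / (((b 1 - b 0) * (b 2 - b 0) : ℝ) : ℂ)) +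
    ((b 2 * b 0 : ℝ) : ℂ) * ((halfUnit b 2 * halfUnit b 0 / halfUnit b 1) / (((b 2 - b 1) * (b 0 - b 1) : ℝ) : ℂ)) +
    ((b 0 * b 1 : ℝ) : ℂ) * ((halfUnit b 0 * halfUnit b 1 / halfUnit b 2) / (((b 0 - b 2) * (b 1 - b 2) : ℝ) : ℂ)) := by
  simp only [atomG, shiftN, Fin.sum_univ_three, shiftWoverB_zero_halfUnit, shiftWoverB_one_halfUnit,
    shiftWoverB_two_halfUnit, Matrix.cons_val_zero, Matrix.cons_val_one, Matrix.cons_val_two, Matrix.tail_cons,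
    Matrix.head_cons]

end GlueAtom

section ClampedEnd

variable (b : Fin 3 → ℝ) (x₁ x₂ : ℂ)

/-- Evaluating a mode at `t = 0`. [folklore] -/
private theorem mode_zero (m : Fin 3) : cexp (-(I * π * (b m : ℂ) * ((0 : ℝ) : ℂ))) = 1 := by simp

/-- `(−iπz)² = −π²z²`. [folklore] -/
private theorem negIpi_sq'' (z : ℂ) : (-(I * (π : ℂ) * z)) ^ 2 = -((π : ℂ) ^ 2 * z ^ 2) := by
  have : I ^ 2 = -1 := Complex.I_sq
  linear_combination ((π : ℂ) ^ 2 * z ^ 2) * this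

/-- `(−iπz)³ = iπ³z³`. [folklore] -/
private theorem negIpi_cube'' (z : ℂ) : (-(I * (π : ℂ) * z)) ^ 3 = I * ((π : ℂ) ^ 3 * z ^ 3) := by
  have : I ^ 2 = -1 := Complex.I_sq
  linear_combination (-(I * (π : ℂ) ^ 3 * z ^ 3)) * this

set_option maxRecDepth 20000 in
/-- **JET MAP AT THE CLAMPED END, second derivative** (the «reaction» jet of `F⋆_x` at `t = 0`):
`2c₀·F⋆″(0) = −π²·A_N·x₁ + iπ·(A_{N/b} − u₀u₁u₂)·x₂` — the second row of the cell's glue matrix `Γ` times `−π`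
(ls-barrier-num g3 kit j266576; `−u₀u₁u₂ = c_g = Det.shiftGlue0 b`). [cite: Zhang2022LandauSiegel, §7 Prop. 7.1 p.44; Lemma 15.1; §18 (18.1)] -/
theorem clampedExtDD_zero (h01 : b 0 ≠ b 1) (h02 : b 0 ≠ b 2) (h12 : b 1 ≠ b 2) (hQ : dblQ b ≠ 0) :
    2 * ((atomA0 b).re : ℂ) * extremalDD b (clampedCoeff b x₁ x₂) 0 =
      -((π : ℂ) ^ 2 * atomAN b) * x₁ +
        I * (π : ℂ) * (atomG b - halfUnit b 0 * halfUnit b 1 * halfUnit b 2) * x₂ := by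
  have hπ : (π : ℂ) ≠ 0 := by exact_mod_cast Real.pi_ne_zero
  have h0 := halfUnit_ne_zero b 0; have h1 := halfUnit_ne_zero b 1; have h2 := halfUnit_ne_zero b 2
  have h01' : ((b 0 : ℝ) : ℂ) - (b 1 : ℂ) ≠ 0 := by rw [sub_ne_zero]; exact_mod_cast h01
  have h02' : ((b 0 : ℝ) : ℂ) - (b 2 : ℂ) ≠ 0 := by rw [sub_ne_zero]; exact_mod_cast h02
  have h12' : ((b 1 : ℝ) : ℂ) - (b 2 : ℂ) ≠ 0 := by rw [sub_ne_zero]; exact_mod_cast h12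
  have h10' : ((b 1 : ℝ) : ℂ) - (b 0 : ℂ) ≠ 0 := by rw [sub_ne_zero]; exact_mod_cast (Ne.symm h01)
  have h20' : ((b 2 : ℝ) : ℂ) - (b 0 : ℂ) ≠ 0 := by rw [sub_ne_zero]; exact_mod_cast (Ne.symm h02)
  have h21' : ((b 2 : ℝ) : ℂ) - (b 1 : ℂ) ≠ 0 := by rw [sub_ne_zero]; exact_mod_cast (Ne.symm h12)
  have hD := dblD_ne_zero b h01 h02 h12
  have hI : I ≠ 0 := Complex.I_ne_zero
  rw [re_atomA0_closed b h01 h02 h12, atomAN_closed b h01 h02 h12, atomG_halfUnit]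
  unfold extremalDD
  simp only [Fin.sum_univ_three, clampedCoeff_succ_zero, clampedCoeff_succ_one, clampedCoeff_succ_two, mode_zero,
    mul_one]
  simp only [clampedCoeff1, clampedCoeff2, clampedCoeff3, negIpi_sq'']
  unfold dblD at hD ⊢
  push_cast at hD ⊢
  field_simp
  unfold dblQ
  ring_nf

set_option maxRecDepth 20000 in
/-- **JET MAP AT THE CLAMPED END, third derivative**: `2c₀·(F⋆‴(0) + iπe₁F⋆″(0)) = −iπ³e₃·A₀·x₁ − π²·A_N·x₂` — the first
row of `Γ` times `−π` (ls-barrier-num g3 kit j266576). [cite: Zhang2022LandauSiegel, §7 Prop. 7.1 p.44; Lemma 15.1; §18 (18.1)] -/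
theorem clampedExtDDD_zero (h01 : b 0 ≠ b 1) (h02 : b 0 ≠ b 2) (h12 : b 1 ≠ b 2) (hQ : dblQ b ≠ 0) :
    2 * ((atomA0 b).re : ℂ) * (extremalDDD b (clampedCoeff b x₁ x₂) 0 +
        I * (π : ℂ) * ((b 0 + b 1 + b 2 : ℝ) : ℂ) * extremalDD b (clampedCoeff b x₁ x₂) 0) =
      -(I * (π : ℂ) ^ 3 * ((b 0 * b 1 * b 2 : ℝ) : ℂ) * atomA0 b) * x₁ - (π : ℂ) ^ 2 * atomAN b * x₂ := by
  have hπ : (π : ℂ) ≠ 0 := by exact_mod_cast Real.pi_ne_zero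
  have h0 := halfUnit_ne_zero b 0; have h1 := halfUnit_ne_zero b 1; have h2 := halfUnit_ne_zero b 2
  have h01' : ((b 0 : ℝ) : ℂ) - (b 1 : ℂ) ≠ 0 := by rw [sub_ne_zero]; exact_mod_cast h01
  have h02' : ((b 0 : ℝ) : ℂ) - (b 2 : ℂ) ≠ 0 := by rw [sub_ne_zero]; exact_mod_cast h02
  have h12' : ((b 1 : ℝ) : ℂ) - (b 2 : ℂ) ≠ 0 := by rw [sub_ne_zero]; exact_mod_cast h12
  have h10' : ((b 1 : ℝ) : ℂ) - (b 0 : ℂ) ≠ 0 := by rw [sub_ne_zero]; exact_mod_cast (Ne.symm h01)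
  have h20' : ((b 2 : ℝ) : ℂ) - (b 0 : ℂ) ≠ 0 := by rw [sub_ne_zero]; exact_mod_cast (Ne.symm h02)
  have h21' : ((b 2 : ℝ) : ℂ) - (b 1 : ℂ) ≠ 0 := by rw [sub_ne_zero]; exact_mod_cast (Ne.symm h12)
  have hD := dblD_ne_zero b h01 h02 h12
  have hI : I ≠ 0 := Complex.I_ne_zero
  rw [re_atomA0_closed b h01 h02 h12, atomAN_closed b h01 h02 h12, atomA0_halfUnit]
  unfold extremalDD extremalDDD
  simp only [Fin.sum_univ_three, clampedCoeff_succ_zero, clampedCoeff_succ_one, clampedCoeff_succ_two, mode_zero,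
    mul_one]
  simp only [clampedCoeff1, clampedCoeff2, clampedCoeff3, negIpi_sq'', negIpi_cube'']
  unfold dblD at hD ⊢
  push_cast at hD ⊢
  field_simp
  unfold dblQ
  ring_nf
  simp only [Complex.I_sq]
  ring_nf

end ClampedEnd

/-! ### Part 4 — the TWO-POINT identity (assembly) -/

section Assembly

variable (b : Fin 3 → ℝ) (p₁ q₁ p₂ q₂ : ℂ)

/-- **The cell's formula-II glue block in atoms** (data `x_i = (p_i, q_i) = (S_i(0), S_i′(0)) = (∫g_i, −g_i(0))`):
`−i·[A_{N/b}·q₁q₂ + iπA_N·(q₁p₂ + p₁q₂) − π²e₃A₀·p₁p₂ − u₀u₁u₂·q₁q₂]` — equal to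
`F0DetC (shiftGlueW b) (shiftGlue0 b) b (−q₁) p₁ (−q₂) p₂` of `DetectorGlueForm` for `b_j ≠ 0` (dictionary lemma in the
assembly file; here no division by `b_j` occurs). [cite: Zhang2022LandauSiegel, Prop 14.1, Lemma 15.1, §18 (18.1)] -/
def twoPointGlue (b : Fin 3 → ℝ) (p₁ q₁ p₂ q₂ : ℂ) : ℂ :=
  -I * (atomG b * q₁ * q₂ + I * π * atomAN b * (q₁ * p₂ + p₁ * q₂)
    - (π : ℂ) ^ 2 * ((b 0 * b 1 * b 2 : ℝ) : ℂ) * atomA0 b * p₁ * p₂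
    - halfUnit b 0 * halfUnit b 1 * halfUnit b 2 * q₁ * q₂)

/-- Pointwise algebra of the two-point assembly: twice the target against the real parts of the two jet brackets,
all atoms opaque. [folklore] -/
private theorem assembly2_aux (a0 aN G U : ℂ) (abim e₁ e₂ e₃ : ℝ) (p₁ q₁ p₂ q₂ : ℂ) :
    2 * ((-(a0.im / 2) * (π ^ 3 * e₃ * ‖p₁‖ ^ 2 + π * e₁ * ‖q₁‖ ^ 2) + π * abim * ‖q₁‖ ^ 2
            + π ^ 2 * (aN * q₁ * conj p₁).re)
          + (-(a0.im / 2) * (π ^ 3 * e₃ * ‖p₂‖ ^ 2 + π * e₁ * ‖q₂‖ ^ 2) + π * abim * ‖q₂‖ ^ 2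
            + π ^ 2 * (aN * q₂ * conj p₂).re)
          + π * (-I * (G * q₁ * q₂ + I * π * aN * (q₁ * p₂ + p₁ * q₂) - (π : ℂ) ^ 2 * (e₃ : ℂ) * a0 * p₁ * p₂
            - U * q₁ * q₂)).re) =
      (conj q₁ * (((π : ℂ) ^ 2 * conj aN * p₁ +
              (2 * (π : ℂ) * (abim : ℂ) - (π : ℂ) * (e₁ : ℂ) * (a0.im : ℂ) - I * (π : ℂ) * (e₁ : ℂ) * (a0.re : ℂ)) * q₁)
            - conj (-((π : ℂ) ^ 2 * aN) * p₂ + I * (π : ℂ) * (G - U) * q₂)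
            + I * π * (e₁ : ℂ) * (a0.re : ℂ) * q₁) +
        conj p₁ * (-(((π : ℂ) ^ 3 * (e₃ : ℂ) * (a0.im : ℂ) + I * (π : ℂ) ^ 3 * (e₃ : ℂ) * (a0.re : ℂ)) * p₁ +
                (2 * (π : ℂ) ^ 2 * (e₂ : ℂ) * (a0.re : ℂ) - (π : ℂ) ^ 2 * aN) * q₁
              + conj (-(I * (π : ℂ) ^ 3 * (e₃ : ℂ) * a0) * p₂ - (π : ℂ) ^ 2 * aN * q₂))
            + 2 * (a0.re : ℂ) * (π : ℂ) ^ 2 * (e₂ : ℂ) * q₁ + I * (π : ℂ) ^ 3 * (e₃ : ℂ) * (a0.re : ℂ) * p₁)).re -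
      (conj (conj q₂) * ((-((π : ℂ) ^ 2 * aN) * p₁ + I * (π : ℂ) * (G - U) * q₁)
            - conj ((π : ℂ) ^ 2 * conj aN * p₂ +
              (2 * (π : ℂ) * (abim : ℂ) - (π : ℂ) * (e₁ : ℂ) * (a0.im : ℂ) - I * (π : ℂ) * (e₁ : ℂ) * (a0.re : ℂ)) * q₂)
            + I * π * (e₁ : ℂ) * (a0.re : ℂ) * conj q₂) +
        conj (-conj p₂) * (-((-(I * (π : ℂ) ^ 3 * (e₃ : ℂ) * a0) * p₁ - (π : ℂ) ^ 2 * aN * q₁)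
              + conj (((π : ℂ) ^ 3 * (e₃ : ℂ) * (a0.im : ℂ) + I * (π : ℂ) ^ 3 * (e₃ : ℂ) * (a0.re : ℂ)) * p₂ +
                (2 * (π : ℂ) ^ 2 * (e₂ : ℂ) * (a0.re : ℂ) - (π : ℂ) ^ 2 * aN) * q₂))
            + 2 * (a0.re : ℂ) * (π : ℂ) ^ 2 * (e₂ : ℂ) * conj q₂ + I * (π : ℂ) ^ 3 * (e₃ : ℂ) * (a0.re : ℂ) * (-conj p₂))).re := by
  rw [Complex.sq_norm, Complex.sq_norm, Complex.sq_norm, Complex.sq_norm, Complex.normSq_apply, Complex.normSq_apply,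
    Complex.normSq_apply, Complex.normSq_apply]
  simp only [pow_succ, pow_zero, one_mul, Complex.add_re, Complex.sub_re, Complex.neg_re, Complex.mul_re,
    Complex.mul_im, Complex.add_im, Complex.sub_im, Complex.neg_im, Complex.conj_re, Complex.conj_im, Complex.I_re,
    Complex.I_im, Complex.ofReal_re, Complex.ofReal_im, Complex.re_ofNat, Complex.im_ofNat]
  ring

/-- Conjugated form of the data-end jet map (second derivative). [cite: Zhang2022LandauSiegel, §7 Prop. 7.1 p.44] -/
private theorem clampedExtDD_one_conj (h01 : b 0 ≠ b 1) (h02 : b 0 ≠ b 2) (h12 : b 1 ≠ b 2) (hQ : dblQ b ≠ 0)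
    (x₁ x₂ : ℂ) :
    2 * ((atomA0 b).re : ℂ) * conj (extremalDD b (clampedCoeff b x₁ x₂) 1) =
      conj ((π : ℂ) ^ 2 * conj (atomAN b) * x₁ +
        (2 * (π : ℂ) * ((atomAb b).im : ℂ) - (π : ℂ) * ((b 0 + b 1 + b 2 : ℝ) : ℂ) * ((atomA0 b).im : ℂ) -
          I * (π : ℂ) * ((b 0 + b 1 + b 2 : ℝ) : ℂ) * ((atomA0 b).re : ℂ)) * x₂) := by
  rw [← clampedExtDD_one b x₁ x₂ h01 h02 h12 hQ]
  simp only [map_mul, map_ofNat, Complex.conj_ofReal]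

/-- Conjugated form of the data-end jet map (third derivative). [cite: Zhang2022LandauSiegel, §7 Prop. 7.1 p.44] -/
private theorem clampedExtDDD_one_conj (h01 : b 0 ≠ b 1) (h02 : b 0 ≠ b 2) (h12 : b 1 ≠ b 2) (hQ : dblQ b ≠ 0)
    (x₁ x₂ : ℂ) :
    2 * ((atomA0 b).re : ℂ) * (conj (extremalDDD b (clampedCoeff b x₁ x₂) 1) -
        I * (π : ℂ) * ((b 0 + b 1 + b 2 : ℝ) : ℂ) * conj (extremalDD b (clampedCoeff b x₁ x₂) 1)) =
      conj (((π : ℂ) ^ 3 * ((b 0 * b 1 * b 2 : ℝ) : ℂ) * ((atomA0 b).im : ℂ) +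
          I * (π : ℂ) ^ 3 * ((b 0 * b 1 * b 2 : ℝ) : ℂ) * ((atomA0 b).re : ℂ)) * x₁ +
        (2 * (π : ℂ) ^ 2 * ((b 0 * b 1 + b 1 * b 2 + b 2 * b 0 : ℝ) : ℂ) * ((atomA0 b).re : ℂ) -
          (π : ℂ) ^ 2 * atomAN b) * x₂) := by
  rw [← clampedExtDDD_one b x₁ x₂ h01 h02 h12 hQ]
  simp only [map_mul, map_add, map_ofNat, Complex.conj_ofReal, Complex.conj_I]
  ring

/-- Conjugated form of the clamped-end jet map (second derivative). [cite: Zhang2022LandauSiegel, §7 Prop. 7.1 p.44] -/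
private theorem clampedExtDD_zero_conj (h01 : b 0 ≠ b 1) (h02 : b 0 ≠ b 2) (h12 : b 1 ≠ b 2) (hQ : dblQ b ≠ 0)
    (x₁ x₂ : ℂ) :
    2 * ((atomA0 b).re : ℂ) * conj (extremalDD b (clampedCoeff b x₁ x₂) 0) =
      conj (-((π : ℂ) ^ 2 * atomAN b) * x₁ +
        I * (π : ℂ) * (atomG b - halfUnit b 0 * halfUnit b 1 * halfUnit b 2) * x₂) := by
  rw [← clampedExtDD_zero b x₁ x₂ h01 h02 h12 hQ]
  simp only [map_mul, map_ofNat, Complex.conj_ofReal]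

/-- Conjugated form of the clamped-end jet map (third derivative). [cite: Zhang2022LandauSiegel, §7 Prop. 7.1 p.44] -/
private theorem clampedExtDDD_zero_conj (h01 : b 0 ≠ b 1) (h02 : b 0 ≠ b 2) (h12 : b 1 ≠ b 2) (hQ : dblQ b ≠ 0)
    (x₁ x₂ : ℂ) :
    2 * ((atomA0 b).re : ℂ) * (conj (extremalDDD b (clampedCoeff b x₁ x₂) 0) -
        I * (π : ℂ) * ((b 0 + b 1 + b 2 : ℝ) : ℂ) * conj (extremalDD b (clampedCoeff b x₁ x₂) 0)) =
      conj (-(I * (π : ℂ) ^ 3 * ((b 0 * b 1 * b 2 : ℝ) : ℂ) * atomA0 b) * x₁ - (π : ℂ) ^ 2 * atomAN b * x₂) := by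
  rw [← clampedExtDDD_zero b x₁ x₂ h01 h02 h12 hQ]
  simp only [map_mul, map_add, map_ofNat, Complex.conj_ofReal, Complex.conj_I]
  ring

/-- **THE TWO-POINT IDENTITY (K2″).** For pairwise distinct `b` with `Q(b,u) ≠ 0` (⟺ `c₀(b) ≠ 0`) and all data
`p₁ q₁ p₂ q₂`, the exponential extremal `E` with jets `(E, E′)(0) = (−conj p₂, conj q₂)` and `(E, E′)(1) = (p₁, q₁)`
satisfies `c₀(b)·T_b^([0,1])(E) = freeEndForm b p₁ q₁ + freeEndForm b p₂ q₂ + π·Re(twoPointGlue b p₁ q₁ p₂ q₂)`: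
Zhang's two free-end boundary forms PLUS the cell's formula-II glue block are, together, `c₀` times the bulk energy of ONE
unit-length extremal arc joining the two free ends (far jet conjugated and sign-reflected). With `p₂ = q₂ = 0` this is the
doubling identity D1 (`doublingIdentity_clamped`). Two-lineage exact of record (num-2 j266016, num-1 j265851, barrier-num
j266075/j266471); here a kernel theorem. [cite: Zhang2022LandauSiegel, §2 (2.32)–(2.33); §7 Prop. 7.1 p.44; Prop 14.1; Lemma 15.1; §18 (18.1)] -/
theorem twoPointIdentity (h01 : b 0 ≠ b 1) (h02 : b 0 ≠ b 2) (h12 : b 1 ≠ b 2) (hQ : dblQ b ≠ 0) :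
    (atomA0 b).re *
        bulkFormOn b 0 1 (extremal b (twoPointCoeff b p₁ q₁ p₂ q₂)) (extremalD b (twoPointCoeff b p₁ q₁ p₂ q₂))
          (extremalDD b (twoPointCoeff b p₁ q₁ p₂ q₂))
      = freeEndForm b p₁ q₁ + freeEndForm b p₂ q₂ + π * (twoPointGlue b p₁ q₁ p₂ q₂).re := by
  rw [bulkFormOn_extremal_eq_jetBracket]
  -- the four jet maps for side 1 (data `(p₁,q₁)`) and the four conjugated ones for side 2 (data `(p₂,q₂)`)
  have h2 := clampedExtDD_one b p₁ q₁ h01 h02 h12 hQ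
  have h3 := clampedExtDDD_one b p₁ q₁ h01 h02 h12 hQ
  have z2 := clampedExtDD_zero b p₁ q₁ h01 h02 h12 hQ
  have z3 := clampedExtDDD_zero b p₁ q₁ h01 h02 h12 hQ
  have k2 := clampedExtDD_zero_conj b h01 h02 h12 hQ p₂ q₂
  have k3 := clampedExtDDD_zero_conj b h01 h02 h12 hQ p₂ q₂
  have k2' := clampedExtDD_one_conj b h01 h02 h12 hQ p₂ q₂
  have k3' := clampedExtDDD_one_conj b h01 h02 h12 hQ p₂ q₂
  have hE1 : 2 * ((atomA0 b).re : ℂ) * jetBracket b (twoPointCoeff b p₁ q₁ p₂ q₂) 1 =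
      conj q₁ * (((π : ℂ) ^ 2 * conj (atomAN b) * p₁ +
              (2 * (π : ℂ) * ((atomAb b).im : ℂ) - (π : ℂ) * ((b 0 + b 1 + b 2 : ℝ) : ℂ) * ((atomA0 b).im : ℂ) -
                I * (π : ℂ) * ((b 0 + b 1 + b 2 : ℝ) : ℂ) * ((atomA0 b).re : ℂ)) * q₁)
            - conj (-((π : ℂ) ^ 2 * atomAN b) * p₂ +
                I * (π : ℂ) * (atomG b - halfUnit b 0 * halfUnit b 1 * halfUnit b 2) * q₂)
            + I * π * ((b 0 + b 1 + b 2 : ℝ) : ℂ) * ((atomA0 b).re : ℂ) * q₁) +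
        conj p₁ * (-(((π : ℂ) ^ 3 * ((b 0 * b 1 * b 2 : ℝ) : ℂ) * ((atomA0 b).im : ℂ) +
                  I * (π : ℂ) ^ 3 * ((b 0 * b 1 * b 2 : ℝ) : ℂ) * ((atomA0 b).re : ℂ)) * p₁ +
                (2 * (π : ℂ) ^ 2 * ((b 0 * b 1 + b 1 * b 2 + b 2 * b 0 : ℝ) : ℂ) * ((atomA0 b).re : ℂ) -
                  (π : ℂ) ^ 2 * atomAN b) * q₁
              + conj (-(I * (π : ℂ) ^ 3 * ((b 0 * b 1 * b 2 : ℝ) : ℂ) * atomA0 b) * p₂ - (π : ℂ) ^ 2 * atomAN b * q₂))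
            + 2 * ((atomA0 b).re : ℂ) * (π : ℂ) ^ 2 * ((b 0 * b 1 + b 1 * b 2 + b 2 * b 0 : ℝ) : ℂ) * q₁ +
            I * (π : ℂ) ^ 3 * ((b 0 * b 1 * b 2 : ℝ) : ℂ) * ((atomA0 b).re : ℂ) * p₁) := by
    unfold jetBracket
    rw [twoPointExt_one b p₁ q₁ p₂ q₂ hQ, twoPointExtD_one b p₁ q₁ p₂ q₂ hQ, twoPointExtDD_one, twoPointExtDDD_one]
    linear_combination (conj q₁) * h2 - (conj q₁) * k2 - (conj p₁) * h3 - (conj p₁) * k3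
  have hE0 : 2 * ((atomA0 b).re : ℂ) * jetBracket b (twoPointCoeff b p₁ q₁ p₂ q₂) 0 =
      conj (conj q₂) * ((-((π : ℂ) ^ 2 * atomAN b) * p₁ +
              I * (π : ℂ) * (atomG b - halfUnit b 0 * halfUnit b 1 * halfUnit b 2) * q₁)
            - conj ((π : ℂ) ^ 2 * conj (atomAN b) * p₂ +
              (2 * (π : ℂ) * ((atomAb b).im : ℂ) - (π : ℂ) * ((b 0 + b 1 + b 2 : ℝ) : ℂ) * ((atomA0 b).im : ℂ) -
                I * (π : ℂ) * ((b 0 + b 1 + b 2 : ℝ) : ℂ) * ((atomA0 b).re : ℂ)) * q₂)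
            + I * π * ((b 0 + b 1 + b 2 : ℝ) : ℂ) * ((atomA0 b).re : ℂ) * conj q₂) +
        conj (-conj p₂) * (-((-(I * (π : ℂ) ^ 3 * ((b 0 * b 1 * b 2 : ℝ) : ℂ) * atomA0 b) * p₁ - (π : ℂ) ^ 2 * atomAN b * q₁)
              + conj (((π : ℂ) ^ 3 * ((b 0 * b 1 * b 2 : ℝ) : ℂ) * ((atomA0 b).im : ℂ) +
                  I * (π : ℂ) ^ 3 * ((b 0 * b 1 * b 2 : ℝ) : ℂ) * ((atomA0 b).re : ℂ)) * p₂ +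
                (2 * (π : ℂ) ^ 2 * ((b 0 * b 1 + b 1 * b 2 + b 2 * b 0 : ℝ) : ℂ) * ((atomA0 b).re : ℂ) -
                  (π : ℂ) ^ 2 * atomAN b) * q₂))
            + 2 * ((atomA0 b).re : ℂ) * (π : ℂ) ^ 2 * ((b 0 * b 1 + b 1 * b 2 + b 2 * b 0 : ℝ) : ℂ) * conj q₂ +
            I * (π : ℂ) ^ 3 * ((b 0 * b 1 * b 2 : ℝ) : ℂ) * ((atomA0 b).re : ℂ) * (-conj p₂)) := by
    unfold jetBracket
    rw [twoPointExt_zero b p₁ q₁ p₂ q₂ hQ, twoPointExtD_zero b p₁ q₁ p₂ q₂ hQ, twoPointExtDD_zero, twoPointExtDDD_zero]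
    linear_combination (conj (conj q₂)) * z2 - (conj (conj q₂)) * k2' - (conj (-conj p₂)) * z3
      - (conj (-conj p₂)) * k3'
  have hre1 : 2 * ((atomA0 b).re * (jetBracket b (twoPointCoeff b p₁ q₁ p₂ q₂) 1).re) =
      (2 * ((atomA0 b).re : ℂ) * jetBracket b (twoPointCoeff b p₁ q₁ p₂ q₂) 1).re := by
    simp only [Complex.mul_re, Complex.mul_im, Complex.ofReal_re, Complex.ofReal_im, Complex.re_ofNat, Complex.im_ofNat]
    ring
  have hre0 : 2 * ((atomA0 b).re * (jetBracket b (twoPointCoeff b p₁ q₁ p₂ q₂) 0).re) =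
      (2 * ((atomA0 b).re : ℂ) * jetBracket b (twoPointCoeff b p₁ q₁ p₂ q₂) 0).re := by
    simp only [Complex.mul_re, Complex.mul_im, Complex.ofReal_re, Complex.ofReal_im, Complex.re_ofNat, Complex.im_ofNat]
    ring
  have key := assembly2_aux (atomA0 b) (atomAN b) (atomG b) (halfUnit b 0 * halfUnit b 1 * halfUnit b 2)
    (atomAb b).im (b 0 + b 1 + b 2) (b 0 * b 1 + b 1 * b 2 + b 2 * b 0) (b 0 * b 1 * b 2) p₁ q₁ p₂ q₂
  rw [← hE1, ← hE0, ← hre1, ← hre0] at key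
  unfold freeEndForm twoPointGlue
  linarith

end Assembly

/-! ### Part 5 — the identity under `c₀ ≠ 0`, and the ∃-shape the two-sided assembly (K6″) consumes -/

section Interface

variable (b : Fin 3 → ℝ) (p₁ q₁ p₂ q₂ : ℂ)

/-- **The two-point identity under `c₀ ≠ 0`** (at a sign-admissible `b`, `c₀ > 0` is the tree's `Det.re_sum_shiftW_pos`).
[cite: Zhang2022LandauSiegel, §2 (2.32)–(2.33); §7 Prop. 7.1 p.44; Lemma 15.1; §18 (18.1)] -/
theorem twoPointIdentity_of_re_ne_zero (h01 : b 0 ≠ b 1) (h02 : b 0 ≠ b 2) (h12 : b 1 ≠ b 2)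
    (hc : (atomA0 b).re ≠ 0) :
    (atomA0 b).re *
        bulkFormOn b 0 1 (extremal b (twoPointCoeff b p₁ q₁ p₂ q₂)) (extremalD b (twoPointCoeff b p₁ q₁ p₂ q₂))
          (extremalDD b (twoPointCoeff b p₁ q₁ p₂ q₂))
      = freeEndForm b p₁ q₁ + freeEndForm b p₂ q₂ + π * (twoPointGlue b p₁ q₁ p₂ q₂).re :=
  twoPointIdentity b p₁ q₁ p₂ q₂ h01 h02 h12 (dblQ_ne_zero_of_re_atomA0_ne_zero b h01 h02 h12 hc)

/-- With `c₀ ≠ 0` the two-point extremal has the prescribed jets at both ends (all four conditions).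
[cite: Zhang2022LandauSiegel, §7 Prop. 7.1 p.44; Lemma 15.1] -/
theorem twoPointExt_boundary_of_re_ne_zero (h01 : b 0 ≠ b 1) (h02 : b 0 ≠ b 2) (h12 : b 1 ≠ b 2)
    (hc : (atomA0 b).re ≠ 0) :
    extremal b (twoPointCoeff b p₁ q₁ p₂ q₂) 0 = -conj p₂ ∧ extremalD b (twoPointCoeff b p₁ q₁ p₂ q₂) 0 = conj q₂ ∧
      extremal b (twoPointCoeff b p₁ q₁ p₂ q₂) 1 = p₁ ∧ extremalD b (twoPointCoeff b p₁ q₁ p₂ q₂) 1 = q₁ :=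
  have hQ := dblQ_ne_zero_of_re_atomA0_ne_zero b h01 h02 h12 hc
  ⟨twoPointExt_zero b p₁ q₁ p₂ q₂ hQ, twoPointExtD_zero b p₁ q₁ p₂ q₂ hQ, twoPointExt_one b p₁ q₁ p₂ q₂ hQ,
    twoPointExtD_one b p₁ q₁ p₂ q₂ hQ⟩

/-- **[K2″] in the ∃-shape of the two-sided assembly** (ls-barrier-p5 g4's `formDetGlued_nonneg_of_twoPointPieces`
interface, 2026-08-27T03:08:50Z): for pairwise-distinct `b` with `c₀ ≠ 0` and every `p₁ q₁ p₂ q₂` there is a piece `E`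
on `[0,1]` with continuous `E, E′, E″`, right-derivatives on the open piece, jets `(−conj p₂, conj q₂)` at `0` and
`(p₁, q₁)` at `1`, and `c₀·T_b^([0,1])(E) = freeEndForm b p₁ q₁ + freeEndForm b p₂ q₂ + π·Re(twoPointGlue b p₁ q₁ p₂ q₂)`
(the glue written in atoms; `= π·Re F0DetC (shiftGlueW b) (shiftGlue0 b) b (−q₁) p₁ (−q₂) p₂` for `b_j ≠ 0`, dictionary
lemma with the assembly). [cite: Zhang2022LandauSiegel, §2 (2.32)–(2.33); §7 Prop. 7.1 p.44; Lemma 15.1; §18 (18.1)] -/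
theorem twoPoint_pieces (h01 : b 0 ≠ b 1) (h02 : b 0 ≠ b 2) (h12 : b 1 ≠ b 2)
    (hc : (∑ j : Fin 3, shiftW b j).re ≠ 0) (p₁ q₁ p₂ q₂ : ℂ) :
    ∃ E E' E'' : ℝ → ℂ,
      ContinuousOn E (Set.Icc 0 1) ∧ ContinuousOn E' (Set.Icc 0 1) ∧ ContinuousOn E'' (Set.Icc 0 1) ∧
      (∀ y ∈ Set.Ioo (0:ℝ) 1, HasDerivWithinAt E (E' y) (Set.Ioi y) y) ∧
      (∀ y ∈ Set.Ioo (0:ℝ) 1, HasDerivWithinAt E' (E'' y) (Set.Ioi y) y) ∧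
      E 0 = -conj p₂ ∧ E' 0 = conj q₂ ∧ E 1 = p₁ ∧ E' 1 = q₁ ∧
      (∑ j : Fin 3, shiftW b j).re * bulkFormOn b 0 1 E E' E''
        = freeEndForm b p₁ q₁ + freeEndForm b p₂ q₂ + π * (twoPointGlue b p₁ q₁ p₂ q₂).re := by
  have hc' : (atomA0 b).re ≠ 0 := hc
  obtain ⟨h0, h0', h1, h1'⟩ := twoPointExt_boundary_of_re_ne_zero b p₁ q₁ p₂ q₂ h01 h02 h12 hc'
  set γ := twoPointCoeff b p₁ q₁ p₂ q₂ with hγ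
  have cF : Continuous (extremal b γ) :=
    continuous_iff_continuousAt.2 fun t => (hasDerivAt_extremal b γ t).continuousAt
  have cF1 : Continuous (extremalD b γ) :=
    continuous_iff_continuousAt.2 fun t => (hasDerivAt_extremalD b γ t).continuousAt
  have cF2 : Continuous (extremalDD b γ) :=
    continuous_iff_continuousAt.2 fun t => (hasDerivAt_extremalDD b γ t).continuousAt
  refine ⟨extremal b γ, extremalD b γ, extremalDD b γ, cF.continuousOn, cF1.continuousOn, cF2.continuousOn,
    fun y _ => (hasDerivAt_extremal b γ y).hasDerivWithinAt, fun y _ => (hasDerivAt_extremalD b γ y).hasDerivWithinAt,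
    h0, h0', h1, h1', ?_⟩
  exact twoPointIdentity_of_re_ne_zero b p₁ q₁ p₂ q₂ h01 h02 h12 hc'

end Interface

end Det

end Literature.NumberTheory.LFunctions.Zhang2022
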